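import Literature.Computability.AlgebraicComplexity.DepthThreeChasmGKKSProofs
import HarnessLib
import HarnessLib.Audit

/-!
# The quotient closure of a homogeneous circuit certificate; `ΣΠΣ` pieces with a gate count

File 1 of 2 of the kernel proof of the cube-root chasm `Theorems.Depth4ChasmAxis.DepthFiveChasm`
(product-depth `2`, exponent `O(d^{1/3})`, over `ℂ`; Kumar–Saptharishi 2017, Lemma 28–29); route
`Depth4`, lens-4 of the `decomp-valiant` workshop, generation 22.  Sorry-free; no Literature fact, no
`Prop` definition, no route file imported; tree constructions USED BY NAME.  File 2: `Depth5ChasmKernel`.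
* §1 `quotClosure H` (the one new construction): the certificate on `ι ⊕ ι × ι` whose node `inr (ν, μ)`
  carries the tree's gate quotient `H.quot ν μ` with formal degree `deg ν - deg μ` (Tavenas 2015 §5;
  local equations = the tree's `quot_sum` / `quot_prod` / `quot_eq_zero_of_deg_lt'`).  Every ATOM of
  `H` is a NODE of `quotClosure H`, so the tree's `HomCircuit.exists_sum_prod` runs a SECOND time.
* §2 the tree's GKKS normal form `DepthThreeChasm.isSPS_of_lists` (Fischer, Saxena duality, univariate
  factoring) realised by the tree's `slotCircuit` with the GATE count `spsGates`.
* §3 `exists_piece_circuit`: an atom of formal degree `≤ t₁` has a product-depth-`≤ 1` circuit with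
  `≤ pieceBound #ι #τ t₁ t₂` gates (expand at cut degree `t₂` in the quotient closure, then §2).
-/

set_option linter.dupNamespace false

noncomputable section

open MvPolynomial
open Literature.Computability.AlgebraicComplexity
open Literature.Computability.AlgebraicComplexity.DepthReduction
open Literature.Computability.AlgebraicComplexity.DepthThreeChasm

namespace Summit.ValiantsHypothesis.ValiantsHypothesis.Theorems.Depth5Chasm

universe u v w

/-! ## §1 The quotient closure of a homogeneous circuit certificate -/

section QuotClosure

variable {k : Type u} {σ : Type v} {ι : Type w}

/-- Kind of an original node inside the quotient closure (arguments read in the left summand).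
[cite: Tavenas2015, §5 (proof of Prop. 3)] -/
def liftKind : HKind k σ ι → HKind k σ (ι ⊕ ι × ι)
  | .var j => .var j
  | .const c => .const c
  | .sum args => .sum (args.map fun a => (a.1, Sum.inl a.2))
  | .prod a b => .prod (.inl a) (.inl b)

/-- Kind of the quotient node `[ν : μ]`, `ν ≠ μ`: a `+`-gate gives the weighted sum of the argument
quotients; a `×`-gate gives `[light] × [heavy : μ]` if `deg μ ≤ deg heavy`, else the empty sum; leaves
give the empty sum. [cite: Tavenas2015, §5 (proof of Prop. 3)] -/
def quotKindOf [CommSemiring k] (H : HomCircuit k σ ι) (μ : ι) : HKind k σ ι → HKind k σ (ι ⊕ ι × ι)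
  | .sum args => .sum (args.map fun a => (a.1, Sum.inr (a.2, μ)))
  | .prod a b =>
      if H.deg μ ≤ H.deg (H.heavy a b) then
        .prod (.inl (H.light a b)) (.inr (H.heavy a b, μ))
      else .sum []
  | .var _ => .sum []
  | .const _ => .sum []

/-- Kind of the quotient node `[ν : μ]`: the constant `1` when `ν = μ`, else `quotKindOf`.
[cite: Tavenas2015, §5 (proof of Prop. 3)] -/
def quotKind [CommSemiring k] (H : HomCircuit k σ ι) [DecidableEq ι] (ν μ : ι) : HKind k σ (ι ⊕ ι × ι) :=
  if ν = μ then .const 1 else quotKindOf H μ (H.kind ν)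

/-- Rank in the quotient closure (that of the numerator). [cite: Tavenas2015, §5 (proof of Prop. 3)] -/
def qrank [CommSemiring k] (H : HomCircuit k σ ι) : ι ⊕ ι × ι → ℕ
  | .inl ν => H.rank ν
  | .inr (ν, _) => H.rank ν

/-- Formal degree in the quotient closure: `deg ν - deg μ` at `[ν : μ]`. [cite: Tavenas2015, §5] -/
def qdeg [CommSemiring k] (H : HomCircuit k σ ι) : ι ⊕ ι × ι → ℕ
  | .inl ν => H.deg ν
  | .inr (ν, μ) => H.deg ν - H.deg μ

/-- Kind in the quotient closure. [cite: Tavenas2015, §5 (proof of Prop. 3)] -/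
def qkind [CommSemiring k] (H : HomCircuit k σ ι) [DecidableEq ι] : ι ⊕ ι × ι → HKind k σ (ι ⊕ ι × ι)
  | .inl ν => liftKind (H.kind ν)
  | .inr (ν, μ) => quotKind H ν μ

/-- Value in the quotient closure: `val ν` at `inl ν`, `H.quot ν μ` at `inr (ν, μ)`. [cite: Tavenas2015, §5] -/
def qval [CommSemiring k] (H : HomCircuit k σ ι) [DecidableEq ι] : ι ⊕ ι × ι → MvPolynomial σ k
  | .inl ν => H.val ν
  | .inr (ν, μ) => H.quot ν μ

/-- Inversion of `liftKind` at a variable. [folklore] -/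
theorem liftKind_eq_var {κ : HKind k σ ι} {j : σ} (h : liftKind κ = .var j) : κ = .var j := by
  cases κ <;> cases h; rfl

/-- Inversion of `liftKind` at a constant. [folklore] -/
theorem liftKind_eq_const {κ : HKind k σ ι} {c : k} (h : liftKind κ = .const c) : κ = .const c := by
  cases κ <;> cases h; rfl

/-- Inversion of `liftKind` at a sum. [folklore] -/
theorem liftKind_eq_sum {κ : HKind k σ ι} {args : List (k × (ι ⊕ ι × ι))}
    (h : liftKind κ = .sum args) :
    ∃ args₀, κ = .sum args₀ ∧ args = args₀.map fun a => (a.1, Sum.inl a.2) := by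
  cases κ <;> cases h; exact ⟨_, rfl, rfl⟩

/-- Inversion of `liftKind` at a product. [folklore] -/
theorem liftKind_eq_prod {κ : HKind k σ ι} {x y : ι ⊕ ι × ι} (h : liftKind κ = .prod x y) :
    ∃ a b, κ = .prod a b ∧ x = .inl a ∧ y = .inl b := by
  cases κ <;> cases h; exact ⟨_, _, rfl, rfl, rfl⟩

/-- A quotient node is never a variable. [folklore] -/
theorem quotKind_ne_var [CommSemiring k] (H : HomCircuit k σ ι) [DecidableEq ι] (ν μ : ι) (j : σ) :
    quotKind H ν μ ≠ .var j := by
  intro h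
  unfold quotKind at h
  by_cases hνμ : ν = μ
  · rw [if_pos hνμ] at h; cases h
  · rw [if_neg hνμ] at h
    generalize hk : H.kind ν = κ at h
    cases κ with
    | var i => cases h
    | const c => cases h
    | sum args₀ => cases h
    | prod a b =>
      simp only [quotKindOf] at h
      by_cases hle : H.deg μ ≤ H.deg (H.heavy a b)
      · rw [if_pos hle] at h; cases h
      · rw [if_neg hle] at h; cases h

/-- A quotient node is a constant only on the diagonal, with constant `1`. [folklore] -/
theorem quotKind_const_inv [CommSemiring k] (H : HomCircuit k σ ι) [DecidableEq ι] {ν μ : ι} {c : k}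
    (h : quotKind H ν μ = .const c) : ν = μ ∧ c = 1 := by
  unfold quotKind at h
  by_cases hνμ : ν = μ
  · rw [if_pos hνμ] at h; cases h; exact ⟨hνμ, rfl⟩
  · rw [if_neg hνμ] at h
    exfalso
    generalize hk : H.kind ν = κ at h
    cases κ with
    | var i => cases h
    | const c' => cases h
    | sum args₀ => cases h
    | prod a b =>
      simp only [quotKindOf] at h
      by_cases hle : H.deg μ ≤ H.deg (H.heavy a b)
      · rw [if_pos hle] at h; cases h
      · rw [if_neg hle] at h; cases h

/-- Inversion of the kind of a quotient node at a sum: either the numerator is a `+`-gate and the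
arguments are its arguments' quotients, or the sum is empty and the quotient vanishes.
[cite: Tavenas2015, §5 (proof of Prop. 3)] -/
theorem quotKind_sum_inv [CommSemiring k] (H : HomCircuit k σ ι) [DecidableEq ι] {ν μ : ι}
    {args : List (k × (ι ⊕ ι × ι))} (h : quotKind H ν μ = .sum args) :
    ν ≠ μ ∧ ((∃ args₀, H.kind ν = .sum args₀ ∧ args = args₀.map fun a => (a.1, Sum.inr (a.2, μ))) ∨
      (args = [] ∧ H.quot ν μ = 0)) := by
  unfold quotKind at h
  by_cases hνμ : ν = μ
  · rw [if_pos hνμ] at h; cases h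
  · rw [if_neg hνμ] at h
    refine ⟨hνμ, ?_⟩
    generalize hk : H.kind ν = κ at h
    cases κ with
    | var i => cases h; exact Or.inr ⟨rfl, H.quot_var hk hνμ⟩
    | const c' => cases h; exact Or.inr ⟨rfl, H.quot_const hk hνμ⟩
    | sum args₀ => cases h; exact Or.inl ⟨args₀, rfl, rfl⟩
    | prod a b =>
      simp only [quotKindOf] at h
      by_cases hle : H.deg μ ≤ H.deg (H.heavy a b)
      · rw [if_pos hle] at h; cases h
      · rw [if_neg hle] at h; cases h
        refine Or.inr ⟨rfl, ?_⟩
        rw [H.quot_prod hk hνμ, H.quot_eq_zero_of_deg_lt' (Nat.lt_of_not_le hle), mul_zero]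

/-- Inversion of the kind of a quotient node at a product: the numerator is a `×`-gate with
`deg μ ≤ deg heavy`, and the factors are `[light]` and `[heavy : μ]`.
[cite: Tavenas2015, §5 (proof of Prop. 3)] -/
theorem quotKind_prod_inv [CommSemiring k] (H : HomCircuit k σ ι) [DecidableEq ι] {ν μ : ι} {x y : ι ⊕ ι × ι}
    (h : quotKind H ν μ = .prod x y) :
    ν ≠ μ ∧ ∃ a b, H.kind ν = .prod a b ∧ H.deg μ ≤ H.deg (H.heavy a b) ∧
      x = .inl (H.light a b) ∧ y = .inr (H.heavy a b, μ) := by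
  unfold quotKind at h
  by_cases hνμ : ν = μ
  · rw [if_pos hνμ] at h; cases h
  · rw [if_neg hνμ] at h
    refine ⟨hνμ, ?_⟩
    generalize H.kind ν = κ at h
    cases κ with
    | var i => cases h
    | const c' => cases h
    | sum args₀ => cases h
    | prod a b =>
      simp only [quotKindOf] at h
      by_cases hle : H.deg μ ≤ H.deg (H.heavy a b)
      · rw [if_pos hle] at h; cases h; exact ⟨a, b, rfl, hle, rfl, rfl⟩
      · rw [if_neg hle] at h; cases h

/-- **The quotient closure** of a homogeneous circuit certificate `H` on `ι`: nodes `ι ⊕ ι × ι`, node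
`inr (ν, μ)` = the gate quotient `[ν : μ]` of formal degree `deg ν - deg μ`, with Tavenas' identities
`[ν:μ] = Σ cᵢ [νᵢ:μ]` and `[ν:μ] = [light]·[heavy:μ]` as local equations; every ATOM of `H` is a NODE.
[cite: Tavenas2015, §5 (proof of Prop. 3); ValiantSkyumBerkowitzRackoff1983] -/
def quotClosure [CommSemiring k] (H : HomCircuit k σ ι) [DecidableEq ι] : HomCircuit k σ (ι ⊕ ι × ι) where
  rank := qrank H
  deg := qdeg H
  kind := qkind H
  val := qval H
  wf_var := by
    rintro (ν | ⟨ν, μ⟩) j h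
    · exact H.wf_var ν j (liftKind_eq_var h)
    · exact absurd h (quotKind_ne_var H ν μ j)
  wf_const := by
    rintro (ν | ⟨ν, μ⟩) c h
    · exact H.wf_const ν c (liftKind_eq_const h)
    · obtain ⟨rfl, rfl⟩ := quotKind_const_inv H h
      exact ⟨by change H.quot _ _ = C 1; rw [H.quot_self, C_1], Nat.sub_self _⟩
  wf_sum := by
    rintro (ν | ⟨ν, μ⟩) args h
    · obtain ⟨args₀, hk, rfl⟩ := liftKind_eq_sum h
      obtain ⟨hargs, hval⟩ := H.wf_sum ν args₀ hk
      refine ⟨fun a ha => ?_, ?_⟩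
      · obtain ⟨a₀, ha₀, rfl⟩ := List.mem_map.1 ha
        exact hargs a₀ ha₀
      · change H.val ν = _
        rw [hval, List.map_map]
        rfl
    · rcases quotKind_sum_inv H h with ⟨hne, ⟨args₀, hk, rfl⟩ | ⟨rfl, h0⟩⟩
      · obtain ⟨hargs, -⟩ := H.wf_sum ν args₀ hk
        refine ⟨fun a ha => ?_, ?_⟩
        · obtain ⟨a₀, ha₀, rfl⟩ := List.mem_map.1 ha
          obtain ⟨hr, hd⟩ := hargs a₀ ha₀
          exact ⟨hr, by change H.deg a₀.2 - H.deg μ = H.deg ν - H.deg μ; rw [hd]⟩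
        · change H.quot ν μ = _
          rw [H.quot_sum hk hne, List.map_map]
          rfl
      · refine ⟨fun a ha => by simp at ha, ?_⟩
        change H.quot ν μ = _
        rw [h0]
        simp
  wf_prod := by
    rintro (ν | ⟨ν, μ⟩) x y h
    · obtain ⟨a, b, hk, rfl, rfl⟩ := liftKind_eq_prod h
      exact H.wf_prod ν a b hk
    · obtain ⟨hne, a, b, hk, hle, rfl, rfl⟩ := quotKind_prod_inv H h
      obtain ⟨-, -, hdeg, -⟩ := H.wf_prod ν a b hk
      have hla := H.deg_light_add a b
      refine ⟨H.rank_light_lt hk, H.rank_heavy_lt hk, ?_, H.quot_prod hk hne⟩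
      change H.deg ν - H.deg μ = H.deg (H.light a b) + (H.deg (H.heavy a b) - H.deg μ)
      omega

/-- The node of the quotient closure carrying an atom. [cite: Tavenas2015, §5 (proof of Prop. 3)] -/
def atomNode : HomCircuit.Atom ι → ι ⊕ ι × ι
  | .node ν => .inl ν
  | .quot ν μ => .inr (ν, μ)

/-- The quotient closure computes the atom values at the atom nodes. [cite: Tavenas2015, §5] -/
theorem quotClosure_val_atomNode [CommSemiring k] (H : HomCircuit k σ ι) [DecidableEq ι] (a : HomCircuit.Atom ι) :
    (quotClosure H).val (atomNode a) = H.aval a := by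
  cases a <;> rfl

/-- The quotient closure has the atom degrees at the atom nodes. [cite: Tavenas2015, §5] -/
theorem quotClosure_deg_atomNode [CommSemiring k] (H : HomCircuit k σ ι) [DecidableEq ι] (a : HomCircuit.Atom ι) :
    (quotClosure H).deg (atomNode a) = H.adeg a := by
  cases a <;> rfl

end QuotClosure

/-! ## §2 The `ΣΠΣ` builder with a gate count -/

section Builder

/-- The one-slot affine form `1·X v + 0` is the variable `X v`. [folklore] -/
theorem val_slotVar {k : Type u} [Field k] {σ : Type v} (v : σ) :
    (⟨fun _ => 1, fun _ => v, 0⟩ : AffForm k σ 1).val = X v := by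
  simp [AffForm.val]

/-- Gate count `U·D + U + 1` of the `ΣΠΣ` circuit of the GKKS normal form of `T₀` products of `W`
polynomials of degree `≤ t` over `N` variables. [cite: GuptaKamathKayalSaptharishi2016, Lemma 4.4 and 4.7] -/
def spsGates (T₀ N W t : ℕ) : ℕ :=
  T₀ * (2 ^ W * ((mmax N t + 1) * W + 1)) * (mmax N t * (t * W)) +
    T₀ * (2 ^ W * ((mmax N t + 1) * W + 1)) + 1

/-- `spsGates` is monotone in the number of products. [folklore] -/
theorem spsGates_mono {T₀ T₀' : ℕ} (h : T₀ ≤ T₀') (N W t : ℕ) :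
    spsGates T₀ N W t ≤ spsGates T₀' N W t := by
  unfold spsGates
  exact Nat.add_le_add_right (Nat.add_le_add (Nat.mul_le_mul_right _ (Nat.mul_le_mul_right _ h))
    (Nat.mul_le_mul_right _ h)) 1

/-- **GKKS with a GATE count.** A sum of `≤ T₀` products of `≤ W` polynomials of degree `≤ t` over `ℂ`
has a product-depth-`≤ 1` circuit with `≤ spsGates T₀ N W t` gates (the tree's `isSPS_of_lists`
realised by the tree's `slotCircuit`). [cite: GuptaKamathKayalSaptharishi2016, Thm. 1.1 (§4)] -/
theorem exists_pd1_circuit_of_lists {τ : Type v} [Fintype τ] [DecidableEq τ] [Inhabited τ]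
    {t W T₀ : ℕ} (L : List (List (MvPolynomial τ ℂ))) (hL : L.length ≤ T₀)
    (hT : ∀ T ∈ L, T.length ≤ W ∧ ∀ p ∈ T, p.totalDegree ≤ t) :
    ∃ C : ArithCircuit ℂ τ, C.eval = (L.map List.prod).sum ∧ C.productDepth ≤ 1 ∧
      C.size ≤ spsGates T₀ (Fintype.card τ) W t := by
  obtain ⟨c, φ, hf⟩ := isSPS_of_lists L hL hT
  refine ⟨slotCircuit c φ, (eval_slotCircuit c φ).trans hf.symm, productDepth_slotCircuit_le c φ,
    le_of_eq ?_⟩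
  simp only [spsGates, slotCircuit, ArithCircuit.size, List.length_append, length_layerF,
    length_layerQ, List.length_singleton]

end Builder

/-! ## §3 Two-level expansion: pieces, terms, straight-line programs -/

section TwoLevel

/-- Number of expansion rounds for formal degree `D` at cut degree `t`. [cite: Tavenas2015, §6, Lemma 3] -/
def rounds (D t : ℕ) : ℕ := 8 * D / (t + 1)

/-- Width (number of atoms) of a term after `rounds D t` rounds. [cite: Tavenas2015, §6, Lemma 3] -/
def width (D t : ℕ) : ℕ := 1 + 4 * rounds D t

/-- Gate bound of the product-depth-`≤ 1` circuit of ONE atom of formal degree `≤ t₁` (certificate with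
`S` nodes, `N` variables; cut degree `t₂`). [cite: KumarSaptharishi2017, Lemma 28] -/
def pieceBound (S N t₁ t₂ : ℕ) : ℕ :=
  spsGates (((S + S * S) * (S + S * S)) ^ rounds t₁ t₂) N (width t₁ t₂) t₂

/-- The node bound `4 s (d+1)²` of `SLP.card_node_le`. [cite: Tavenas2015, §4, Prop. 2] -/
def nodeBound (s d : ℕ) : ℕ := 4 * s * (d + 1) ^ 2

/-- Gate bound of the product-depth-`≤ 2` circuit of a degree-`≤ d` value of a straight-line program of
length `s` over `N` variables (level 1 at cut degree `k²`, level 2 at `k`). [cite: KumarSaptharishi2017, Lemma 29] -/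
def slpBound (N d s k : ℕ) : ℕ :=
  (d + 1) * (nodeBound s d * nodeBound s d) ^ rounds d (k ^ 2) * width d (k ^ 2) *
      pieceBound (nodeBound s d) N (k ^ 2) k +
    ((d + 1) * (nodeBound s d * nodeBound s d) ^ rounds d (k ^ 2) * width d (k ^ 2) +
      (d + 1) * (nodeBound s d * nodeBound s d) ^ rounds d (k ^ 2) + 1)

/-- `pieceBound` is monotone in the node count. [folklore] -/
theorem pieceBound_mono {S S' : ℕ} (h : S ≤ S') (N t₁ t₂ : ℕ) :
    pieceBound S N t₁ t₂ ≤ pieceBound S' N t₁ t₂ := by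
  unfold pieceBound
  have h1 : S + S * S ≤ S' + S' * S' := Nat.add_le_add h (Nat.mul_le_mul h h)
  exact spsGates_mono (Nat.pow_le_pow_left (Nat.mul_le_mul h1 h1) (rounds t₁ t₂)) _ _ _

variable {τ : Type v} [Fintype τ] [DecidableEq τ] [Inhabited τ] {ι : Type w} [Fintype ι] [DecidableEq ι]

/-- **Level 2 (one piece).** An atom of formal degree `≤ t₁` of a homogeneous circuit certificate over
`ℂ` has a product-depth-`≤ 1` circuit with `≤ pieceBound #ι #τ t₁ t₂` gates (`t₂ ≥ 1`): expand its
node of the QUOTIENT CLOSURE at cut degree `t₂` (Tavenas), rebuild as `ΣΠΣ` (GKKS).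
[cite: KumarSaptharishi2017, Lemma 28; Tavenas2015, Thm. 1; GuptaKamathKayalSaptharishi2016, Thm. 1.1] -/
theorem exists_piece_circuit (H : HomCircuit ℂ τ ι) {t₁ t₂ : ℕ} (ht₂ : 1 ≤ t₂)
    (a : HomCircuit.Atom ι) (ha : H.adeg a ≤ t₁) :
    ∃ C : ArithCircuit ℂ τ, C.eval = H.aval a ∧ C.productDepth ≤ 1 ∧
      C.size ≤ pieceBound (Fintype.card ι) (Fintype.card τ) t₁ t₂ := by
  obtain ⟨L, hsum, hlen, hT⟩ := (quotClosure H).exists_sum_prod ht₂ (atomNode a)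
  rw [quotClosure_val_atomNode] at hsum
  rw [quotClosure_deg_atomNode] at hlen hT
  have hcard : Fintype.card (ι ⊕ ι × ι) = Fintype.card ι + Fintype.card ι * Fintype.card ι := by
    rw [Fintype.card_sum, Fintype.card_prod]
  rw [hcard] at hlen
  have hR : 8 * H.adeg a / (t₂ + 1) ≤ rounds t₁ t₂ := by
    unfold rounds; apply Nat.div_le_div_right; omega
  have hpos : 0 < (Fintype.card ι + Fintype.card ι * Fintype.card ι) *
      (Fintype.card ι + Fintype.card ι * Fintype.card ι) := by
    haveI : Nonempty ι := ⟨match a with | .node ν => ν | .quot ν _ => ν⟩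
    have : 0 < Fintype.card ι := Fintype.card_pos
    exact Nat.mul_pos (Nat.add_pos_left this _) (Nat.add_pos_left this _)
  have hL : L.length ≤ ((Fintype.card ι + Fintype.card ι * Fintype.card ι) *
      (Fintype.card ι + Fintype.card ι * Fintype.card ι)) ^ rounds t₁ t₂ :=
    hlen.trans (Nat.pow_le_pow_right hpos hR)
  have hT' : ∀ T ∈ L, T.length ≤ width t₁ t₂ ∧ ∀ p ∈ T, p.totalDegree ≤ t₂ := fun T hTm =>
    ⟨(hT T hTm).1.trans (by unfold width; omega), (hT T hTm).2⟩
  obtain ⟨C, hC, hpd, hsize⟩ := exists_pd1_circuit_of_lists L hL hT'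
  exact ⟨C, hC.trans hsum, hpd, hsize⟩

end TwoLevel

end Summit.ValiantsHypothesis.ValiantsHypothesis.Theorems.Depth5Chasm

end
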